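import Summits.BirchSwinnertonDyer.BirchSwinnertonDyer.Theorems.AlignedTransportAtTwoMainConjectureOfRankZeroBSDAtTwoFineRoadOddSplit
import Literature.NumberTheory.EllipticCurves.PrimaryGroupStableImage
import Literature.NumberTheory.EllipticCurves.GaloisActionProofs
import HarnessLib

/-!
# Road (b″) netted, local brick (ii), fine side: the inflation–restriction defect at the prime above `2` is
# FINITE WITHOUT Imai — `H¹(Δ_w, E(K_{∞,w}(μ_{2^∞}))[2^∞])` is finite because `E[2^∞]` is `2`-primary with
# `#E[2] < ∞` (inf–res along a subgroup of index `≤ 2`)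

Cell `bsd-f1-sign2`, WIDTH-5 attach seat `bsd-line-att-p4` (gen 4) on line `birth` of crux C2
stmt-BirchSwinnertonDyer-22298 `MainConjectureOfRankZeroBSDAtTwo`; a `--supports 22298 --as helper` file, sequel of
`…FineRoadInfRes` §3 (att-p4 g2) and `…FineRoadOddSplit` (att-p4 g4). HONEST FRAMING: THEOREMS ONLY — no definition,
no named fact, no `sorry`; BSD is NOT proved by any of this.

WHY. `…FineRoadInfRes` §3 `finite_ker_res_kerCyclotomicCharacter_inf` proves, for ANY subgroup `D ≤ Γ_K`, that the
classes of `H¹(ker κ ⊓ D, E[p^∞])` dying on `ker χ_p ⊓ D` form a finite set GRANTED `hfix` = «`E[p^∞]^{ker χ_p ⊓ D}` is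
finite» (for `D = D_w`, `w ∣ p`: Imai 1975, not a tree fact). At `p = 2` the hypothesis is UNNECESSARY:
`[ker κ ⊓ D : ker χ₂ ⊓ D] ≤ #μ(ℤ₂) = 2`, and for a subgroup `H₁` of index `≤ 2` in `H₂` the inflation–restriction kernel
`H¹(H₂/H₁, A)`, `A = M^{H₁}`, is `B/(σ-1)A` with `B = {a ∈ A | σa = -a} ⊇ (σ-1)A ⊇ 2B`, a quotient of `B/2B`, which is
finite as soon as `M` is `2`-primary with `M[2]` finite (tree `PrimaryGroup.finite_quotient_powRange_one`:
`#(B/2B) ≤ #B[2]`). For `M = E[2^∞]`: `#E[2] = 4`.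

* §1 `finite_ker_resOfLe_of_two_cosets` (any topological group `G`, discrete `G`-module `M` with continuous orbit maps,
  `2`-primary with finite `2`-torsion; `H₁ ≤ H₂ ≤ G`, `H₁` normalised by `H₂`, at most two cosets):
  **`{c ∈ H¹(H₂, M) | res_{H₁} c = 0}` is finite** — the `p = 2`, `hfix`-free companion of `InfRes.finite_ker_resOfLe`.
* §2 **`finite_ker_res_kerCyclotomicCharacter_inf_two`**: for every number field `K`, the cyclotomic `ℤ₂`-extension
  `κ`, every elliptic `W/K` and EVERY subgroup `D ≤ Γ_K`, the classes of `H¹(ker κ ⊓ D, E[2^∞])` restricting to `0` on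
  `ker χ₂ ⊓ D` form a finite set — `InfRes.finite_ker_res_kerCyclotomicCharacter_inf` at `p = 2` with `hfix` REMOVED.
  With `D = D_w`, `w ∣ 2`, `K = ℚ`: the local term at `2` of `coker(res₀ : Sel₀^{rel ∞}(ℚ_∞) → Sel₀(ℚ(ζ_{2^∞}))^Δ)` is
  finite (fine side of brick (ii) of LOCAL-DICTIONARY §7; the odd places contribute nothing by `…OddSplitDescent`, the
  global terms vanish by `…InfResSharp`/`…InfResSurj`). With `D = ⊤`: (ε) of `…FineRoadInfRes` §2 without Ribet.

References: J.-P. Serre, *Galois Cohomology* I §2.6 (inflation–restriction), I §5.1; R. Greenberg, LNM 1716 (1999), §3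
Lemma 3.1 (the same count `#H¹ ≤ #B/B_div` for the layers); H. Imai, Proc. Japan Acad. 51 (1975) (NOT used).
-/

set_option autoImplicit false
-- the Theorems namespace of this sub repeats the summit name by design (D-0017 nested layout)
set_option linter.dupNamespace false

noncomputable section

open scoped Classical AddSubgroup

namespace Summit.BirchSwinnertonDyer.BirchSwinnertonDyer.Theorems.AlignedTransportAtTwoFineRoad.LocalTwo

open WeierstrassCurve NumberField Field Literature.NumberTheory.EllipticCurves
  Literature.NumberTheory.EllipticCurves.GreenbergSelmer Literature.NumberTheory.GaloisRepresentations ZpExtension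

universe u

/-! ## §1 Inflation–restriction along a subgroup of index `≤ 2`: the kernel is finite for `2`-primary coefficients
with finite `2`-torsion -/

section Generic

variable {G : Type u} [Group G] [TopologicalSpace G] [IsTopologicalGroup G]
  {M : Type u} [AddCommGroup M] [DistribMulAction G M] [TopologicalSpace M] [DiscreteTopology M]

/-- **Inflation–restriction, index `≤ 2`, `2`-primary coefficients.** Let `H₁ ≤ H₂` be subgroups of a topological
group `G`, `H₁` normalised by `H₂`, with at most two cosets (`g, g' ∈ H₂ ∖ H₁ ⟹ g g' ∈ H₁`), and `M` a discrete
`G`-module with continuous orbit maps in which every element is killed by a power of `2` and `M[2]` is finite. Then the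
classes of `H¹(H₂, M)` restricting to `0` in `H¹(H₁, M)` form a FINITE set. Proof: a kernel class has a representative
`ψ` vanishing on `H₁`; if `H₂ = H₁` it is `0`; otherwise fix `σ ∈ H₂ ∖ H₁`: `ψ` is determined by `b = ψ(σ) ∈ B`,
`B = {m ∈ M^{H₁} | σ m = -m}`, and `ψ ↦ b mod (σ - 1)M^{H₁}` is injective on classes; `(σ-1)M^{H₁} ∩ B ⊇ 2B` and
`B/2B` is finite (`PrimaryGroup.finite_quotient_powRange_one`). NO finiteness of `M^{H₁}` is assumed (contrast
`InfRes.finite_ker_resOfLe`). [cite: SerreGaloisCohomology1997, I §2.6 (inflation–restriction) and I §5.1]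
[cite: GreenbergLNM1716, §3 Lemma 3.1] -/
theorem finite_ker_resOfLe_of_two_cosets {H₁ H₂ : Subgroup G} (hle : H₁ ≤ H₂)
    (hnorm : ∀ g ∈ H₂, ∀ h ∈ H₁, g⁻¹ * h * g ∈ H₁)
    (htwo : ∀ g ∈ H₂, ∀ g' ∈ H₂, g ∉ H₁ → g' ∉ H₁ → g * g' ∈ H₁)
    (hcont : ∀ m : M, Continuous fun g : G ↦ g • m)
    (hprim : ∀ m : M, ∃ k : ℕ, 2 ^ k • m = 0) (hfin : Set.Finite {m : M | (2 : ℕ) • m = 0}) :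
    Set.Finite {c : subgroupH1 H₂ M | resOfLe M hle c = 0} := by
  set S : Set (subgroupH1 H₂ M) := {c | resOfLe M hle c = 0} with hS
  set U : Subgroup H₂ := H₁.subgroupOf H₂ with hU
  -- Step 1: every kernel class has a representative vanishing on `H₁` (as in `InfRes.finite_ker_resOfLe`)
  have key : ∀ c : S,
      ∃ ψ : contOneCocycles (discreteTopRep H₂ M),
        oneCocycleClass _ ψ = c.1 ∧ ∀ x : H₁, ψ.1 (Subgroup.inclusion hle x) = 0 := by
    rintro ⟨c, hc⟩
    obtain ⟨z, rfl⟩ := oneCocycleClass_surjective (discreteTopRep H₂ M) c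
    obtain ⟨a, ha⟩ := (CocycleCriteria.resOfLe_oneCocycleClass_eq_zero_iff hle z).mp hc
    let π : contOneCocycles (discreteTopRep H₂ M) :=
      ⟨⟨fun g : H₂ ↦ (g : G) • a - a, ((hcont a).comp continuous_subtype_val).sub continuous_const⟩,
        fun g h ↦ by
          change ((g * h : H₂) : G) • a - a =
            ((g : G) • a - a) + (discreteTopRep H₂ M).ρ g (((h : G) • a - a))
          rw [discreteTopRep_ρ_apply, Subgroup.smul_def, Subgroup.coe_mul, mul_smul, smul_sub]
          abel⟩
    have hπ0 : oneCocycleClass _ π = 0 :=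
      (oneCocycleClass_eq_zero_iff _ π).mpr ⟨a, fun g ↦ by rw [discreteTopRep_ρ_apply, Subgroup.smul_def]; rfl⟩
    refine ⟨z - π, ?_, fun x ↦ ?_⟩
    · rw [oneCocycleClass_sub, hπ0, sub_zero]
    · change z.1 (Subgroup.inclusion hle x) - (((Subgroup.inclusion hle x : H₂) : G) • a - a) = 0
      rw [ha x, Subgroup.coe_inclusion, sub_self]
  choose ψ hψc hψ0 using key
  -- values on `H₁` vanish (restated for elements of `H₂` lying in `H₁`)
  have hvan : ∀ c (g : H₂), (g : G) ∈ H₁ → (ψ c).1 g = 0 := by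
    intro c g hg
    have e : Subgroup.inclusion hle ⟨(g : G), hg⟩ = g := Subtype.ext rfl
    rw [← e]
    exact hψ0 c ⟨(g : G), hg⟩
  -- Step 2: representatives are constant on `U`-cosets, with values in `M^{H₁}`
  have hcoset : ∀ c (g k : H₂), k ∈ U → (ψ c).1 (g * k) = (ψ c).1 g := by
    intro c g k hk
    rw [(ψ c).2 g k, hvan c k (Subgroup.mem_subgroupOf.mp hk), map_zero, add_zero]
  have hinv : ∀ c (g : H₂) (h : H₁), (h : G) • (ψ c).1 g = (ψ c).1 g := by
    intro c g h
    set h' : H₂ := Subgroup.inclusion hle h with hh'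
    have h1 : (ψ c).1 (h' * g) = (discreteTopRep H₂ M).ρ h' ((ψ c).1 g) := by
      rw [(ψ c).2 h' g, hψ0 c h, zero_add]
    have hmem : g⁻¹ * h' * g ∈ U := by
      rw [hU, Subgroup.mem_subgroupOf]
      exact hnorm g g.2 h h.2
    have h2 : h' * g = g * (g⁻¹ * h' * g) := by group
    rw [h2, hcoset c g _ hmem, discreteTopRep_ρ_apply, Subgroup.smul_def] at h1
    exact h1.symm
  by_cases hall : ∀ g ∈ H₂, g ∈ H₁
  · -- index one: every kernel class is zero
    refine (Set.finite_singleton (0 : subgroupH1 H₂ M)).subset fun c hc ↦ ?_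
    have e : oneCocycleClass _ (ψ ⟨c, hc⟩) = c := hψc ⟨c, hc⟩
    rw [Set.mem_singleton_iff, ← e]
    refine (oneCocycleClass_eq_zero_iff _ _).mpr ⟨0, fun g ↦ ?_⟩
    rw [map_zero, sub_zero]
    exact hvan _ g (hall g g.2)
  -- index two: fix `σ ∈ H₂ ∖ H₁`
  obtain ⟨σ, hσ⟩ := not_forall.mp hall
  obtain ⟨hσ₂, hσ₁⟩ := Classical.not_imp.mp hσ
  set σ' : H₂ := ⟨σ, hσ₂⟩ with hσ'
  have hσinv : σ⁻¹ ∉ H₁ := fun h ↦ hσ₁ (by simpa using H₁.inv_mem h)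
  have hdec : ∀ g : H₂, (g : G) ∉ H₁ → σ⁻¹ * (g : G) ∈ H₁ := fun g hg ↦
    htwo σ⁻¹ (H₂.inv_mem hσ₂) g g.2 hσinv hg
  -- the value `b_c = ψ_c(σ)` determines `ψ_c`
  have hval : ∀ c (g : H₂), (g : G) ∉ H₁ → (ψ c).1 g = (ψ c).1 σ' := by
    intro c g hg
    have hk : (⟨σ⁻¹ * (g : G), H₂.mul_mem (H₂.inv_mem hσ₂) g.2⟩ : H₂) ∈ U := by
      rw [hU, Subgroup.mem_subgroupOf]
      exact hdec g hg
    have e : g = σ' * ⟨σ⁻¹ * (g : G), H₂.mul_mem (H₂.inv_mem hσ₂) g.2⟩ :=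
      Subtype.ext (by simp [hσ'])
    rw [e, hcoset c σ' _ hk]
  -- `σ • b_c = - b_c`
  have hneg : ∀ c, σ • (ψ c).1 σ' = -(ψ c).1 σ' := by
    intro c
    have hσσ : σ' * σ' ∈ U := by
      rw [hU, Subgroup.mem_subgroupOf]
      exact htwo σ hσ₂ σ hσ₂ hσ₁ hσ₁
    have h1 : (ψ c).1 (σ' * σ') = (ψ c).1 σ' + (discreteTopRep H₂ M).ρ σ' ((ψ c).1 σ') := (ψ c).2 σ' σ'
    rw [hvan c _ (Subgroup.mem_subgroupOf.mp hσσ), discreteTopRep_ρ_apply, Subgroup.smul_def] at h1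
    exact (neg_eq_of_add_eq_zero_right h1.symm).symm
  -- the group `B = {m ∈ M^{H₁} | σ m = -m}` and its subgroup `C = B ∩ (σ - 1) M^{H₁}`
  let B : AddSubgroup M :=
    { carrier := {m | (∀ h : H₁, (h : G) • m = m) ∧ σ • m = -m}
      zero_mem' := ⟨fun _ ↦ smul_zero _, by rw [smul_zero, neg_zero]⟩
      add_mem' := fun {x y} hx hy ↦ ⟨fun h ↦ by rw [smul_add, hx.1 h, hy.1 h],
        by rw [smul_add, hx.2, hy.2, neg_add]⟩
      neg_mem' := fun {x} hx ↦ ⟨fun h ↦ by rw [smul_neg, hx.1 h], by rw [smul_neg, hx.2]⟩ }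
  let C : AddSubgroup B :=
    { carrier := {b | ∃ a : M, (∀ h : H₁, (h : G) • a = a) ∧ (b : M) = σ • a - a}
      zero_mem' := ⟨0, fun _ ↦ smul_zero _, by rw [smul_zero, sub_zero]; rfl⟩
      add_mem' := fun {x y} ⟨a, ha, ex⟩ ⟨a', ha', ey⟩ ↦ ⟨a + a', fun h ↦ by rw [smul_add, ha h, ha' h], by
        rw [AddSubgroup.coe_add, ex, ey, smul_add]; abel⟩
      neg_mem' := fun {x} ⟨a, ha, ex⟩ ↦ ⟨-a, fun h ↦ by rw [smul_neg, ha h], by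
        rw [AddSubgroup.coe_neg, ex, smul_neg]; abel⟩ }
  -- `B / C` is finite: `C ⊇ 2B` and `B/2B` is finite
  have hBprim : ∀ b : B, ∃ k : ℕ, 2 ^ k • b = 0 := fun b ↦ by
    obtain ⟨k, hk⟩ := hprim (b : M)
    exact ⟨k, Subtype.ext (by rw [AddSubgroupClass.coe_nsmul]; exact hk)⟩
  haveI : Finite (B[(2 : ℕ)]) := by
    haveI : Finite {m : M | (2 : ℕ) • m = 0} := hfin.to_subtype
    refine Finite.of_injective (fun x : B[(2 : ℕ)] ↦
      (⟨((x : B) : M), ?_⟩ : {m : M | (2 : ℕ) • m = 0})) ?_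
    · have hx := AddSubgroup.torsionBy.nsmul_iff.mp x.2
      change (2 : ℕ) • ((x : B) : M) = 0
      rw [← AddSubgroupClass.coe_nsmul, hx]; rfl
    · intro x y hxy
      have h := congrArg Subtype.val hxy
      dsimp only at h
      exact Subtype.ext (Subtype.ext h)
  have hfinC : Finite (B ⧸ C) := by
    haveI := (PrimaryGroup.finite_quotient_powRange_one (B := B) 2 hBprim).1
    have hleC : (nsmulAddMonoidHom (2 ^ 1) : B →+ B).range ≤ C := by
      rintro _ ⟨b, rfl⟩
      refine ⟨-(b : M), fun h ↦ by rw [smul_neg, b.2.1 h], ?_⟩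
      rw [nsmulAddMonoidHom_apply, pow_one, AddSubgroupClass.coe_nsmul, smul_neg, b.2.2, neg_neg, sub_neg_eq_add,
        two_nsmul]
    exact Finite.of_surjective (QuotientAddGroup.map _ C (AddMonoidHom.id B) hleC) fun y ↦
      QuotientAddGroup.induction_on y fun x ↦ ⟨QuotientAddGroup.mk x, rfl⟩
  -- Step 3: `c ↦ ψ_c(σ) mod C` is injective on kernel classes
  let Φ : S → B ⧸ C := fun c ↦ QuotientAddGroup.mk ⟨(ψ c).1 σ', fun h ↦ hinv c σ' h, hneg c⟩
  have hΦ : Function.Injective Φ := by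
    intro c c' hcc'
    obtain ⟨a, ha, e⟩ := (QuotientAddGroup.eq_iff_sub_mem.mp hcc')
    rw [AddSubgroup.coe_sub] at e
    change (ψ c).1 σ' - (ψ c').1 σ' = σ • a - a at e
    have hzero : oneCocycleClass _ (ψ c - ψ c') = 0 := by
      refine (oneCocycleClass_eq_zero_iff _ _).mpr ⟨a, fun g ↦ ?_⟩
      rw [discreteTopRep_ρ_apply, Subgroup.smul_def]
      change (ψ c).1 g - (ψ c').1 g = (g : G) • a - a
      by_cases hg : (g : G) ∈ H₁
      · rw [hvan c g hg, hvan c' g hg, sub_zero, ha ⟨(g : G), hg⟩, sub_self]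
      · rw [hval c g hg, hval c' g hg, e]
        have hg' : (g : G) = σ * (σ⁻¹ * (g : G)) := by group
        conv_rhs => rw [hg', mul_smul, ha ⟨σ⁻¹ * (g : G), hdec g hg⟩]
    apply Subtype.ext
    rw [← hψc c, ← hψc c', ← sub_eq_zero, ← oneCocycleClass_sub, hzero]
  haveI : Finite S := Finite.of_injective Φ hΦ
  exact S.toFinite

end Generic

/-! ## §2 The local (and global) inf–res defect of the cyclotomic descent at `p = 2` is finite — no Imai, no Ribet -/

section Two

variable {K : Type} [Field K] (κ : ZpExtension K 2) (W : WeierstrassCurve K) [W.IsElliptic]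

/-- **The inf–res defect at `p = 2` is finite, unconditionally.** For a number field `K`, the CYCLOTOMIC `ℤ₂`-extension
`κ`, an elliptic curve `E = W/K` and ANY subgroup `D ≤ Γ_K`: the classes of `H¹(ker κ ⊓ D, E[2^∞])` restricting to `0`
on `ker χ₂ ⊓ D` form a finite set. Here `[ker κ ⊓ D : ker χ₂ ⊓ D] ≤ #μ(ℤ₂) = 2` (`OddSplit.eq_one_or_eq_neg_one_of_mem_torsion`)
and `E[2^∞]` is `2`-primary with `#E[2] = 4` (`finite_torsionPoints_holds`), so §1 applies. This is
`InfRes.finite_ker_res_kerCyclotomicCharacter_inf` at `p = 2` with the hypothesis `hfix` (Imai 1975: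
`E(K_w(μ_{2^∞}))[2^∞]` finite) REMOVED. With `D = D_w`, `w ∣ 2`, `K = ℚ`: the local term at `2` of
`coker(res₀ : Sel₀^{rel ∞}(ℚ_∞) → Sel₀(ℚ(ζ_{2^∞}))^Δ)` — the group `H¹(Δ_w, E(ℚ_{2}(ζ_{2^∞}))[2^∞])` — is finite;
with `D = ⊤`: (ε) of `…FineRoadInfRes` without Ribet 1981. [cite: SerreGaloisCohomology1997, I §2.6 (inflation–restriction)]
[cite: GreenbergLNM1716, §3 Lemma 3.1] -/
theorem finite_ker_res_kerCyclotomicCharacter_inf_two (hκ : κ.IsCyclotomic)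
    (D : Subgroup (absoluteGaloisGroup K)) :
    Set.Finite {c : W.subgroupH1 2 (κ.kerSubgroup ⊓ D) |
      W.resOfLe 2 (inf_le_inf_right D (InfRes.ker_cyclotomicCharacter_le_kerSubgroup κ hκ)) c = 0} := by
  refine finite_ker_resOfLe_of_two_cosets (M := W.geomPrimaryTorsion 2)
    (inf_le_inf_right D (InfRes.ker_cyclotomicCharacter_le_kerSubgroup κ hκ))
    (fun g hg h hh ↦ ⟨(MonoidHom.normal_ker _).conj_mem' h hh.1 g,
      D.mul_mem (D.mul_mem (D.inv_mem hg.2) hh.2) hg.2⟩)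
    (fun g hg g' hg' hg₁ hg'₁ ↦ ?_) (fun m ↦ W.continuous_smul_geomPrimaryTorsion 2 m) (fun m ↦ ?_) ?_
  · -- at most two cosets: `χ₂(g) = χ₂(g') = -1`
    have htors : ∀ x ∈ κ.kerSubgroup, GaloisRep.cyclotomicCharacter K 2 x ∈ CommGroup.torsion ℤ_[2]ˣ := by
      intro x hx
      rw [show κ.kerSubgroup = _ from hκ] at hx
      exact Subgroup.mem_comap.mp hx
    have hneg : ∀ x ∈ κ.kerSubgroup ⊓ D, x ∉ (GaloisRep.cyclotomicCharacter K 2).toMonoidHom.ker ⊓ D →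
        GaloisRep.cyclotomicCharacter K 2 x = -1 := by
      intro x hx hx'
      rcases OddSplit.eq_one_or_eq_neg_one_of_mem_torsion (htors x hx.1) with h1 | h1
      · exact absurd (Subgroup.mem_inf.mpr ⟨(MonoidHom.mem_ker).mpr h1, hx.2⟩) hx'
      · exact h1
    refine Subgroup.mem_inf.mpr ⟨?_, D.mul_mem hg.2 hg'.2⟩
    have e1 : (GaloisRep.cyclotomicCharacter K 2).toMonoidHom g = -1 := hneg g hg hg₁
    have e2 : (GaloisRep.cyclotomicCharacter K 2).toMonoidHom g' = -1 := hneg g' hg' hg'₁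
    rw [MonoidHom.mem_ker, map_mul, e1, e2, neg_mul_neg, one_mul]
  · -- `E[2^∞]` is `2`-primary
    obtain ⟨k, hk⟩ := (AddCommGroup.mem_primaryComponent).1 m.2
    exact ⟨k, Subtype.ext (by rw [AddSubgroupClass.coe_nsmul]; exact hk)⟩
  · -- `#E[2] < ∞`
    haveI : Finite (geomTorsion W 2) := finite_torsionPoints_holds W (AlgebraicClosure K) two_ne_zero
    haveI : Finite {m : W.geomPrimaryTorsion 2 | (2 : ℕ) • m = 0} := by
      refine Finite.of_injective (fun m : {m : W.geomPrimaryTorsion 2 | (2 : ℕ) • m = 0} ↦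
        (⟨((m : W.geomPrimaryTorsion 2) : W.geomPoints), ?_⟩ : geomTorsion W 2)) ?_
      · have hm : (2 : ℕ) • (m : W.geomPrimaryTorsion 2) = 0 := m.2
        refine AddSubgroup.torsionBy.nsmul_iff.mpr ?_
        rw [← AddSubgroupClass.coe_nsmul, hm]; rfl
      · intro x y hxy
        have h := congrArg Subtype.val hxy
        dsimp only at h
        exact Subtype.ext (Subtype.ext h)
    exact Set.toFinite _

/-- **(ε) at `p = 2` without Ribet**: for the cyclotomic `ℤ₂`-extension of a number field `K` and an elliptic `W/K`,
the classes of `H¹(K_∞^{cyc}, E[2^∞])` restricting to `0` in `H¹(K(μ_{2^∞}), E[2^∞])` form a finite set (`D = ⊤` in the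
previous theorem, transported along `H ⊓ ⊤ = H`); compare `InfRes.finite_ker_res_kerCyclotomicCharacter`, which
displays Ribet 1981 as a hypothesis for general `p`. [cite: SerreGaloisCohomology1997, I §2.6 (inflation–restriction)] -/
theorem finite_ker_res_kerCyclotomicCharacter_two (hκ : κ.IsCyclotomic) :
    Set.Finite {c : W.subgroupH1 2 κ.kerSubgroup |
      W.resOfLe 2 (InfRes.ker_cyclotomicCharacter_le_kerSubgroup κ hκ) c = 0} := by
  refine finite_ker_resOfLe_of_two_cosets (M := W.geomPrimaryTorsion 2)
    (InfRes.ker_cyclotomicCharacter_le_kerSubgroup κ hκ)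
    (fun g _ h hh ↦ (MonoidHom.normal_ker _).conj_mem' h hh g)
    (fun g hg g' hg' hg₁ hg'₁ ↦ ?_) (fun m ↦ W.continuous_smul_geomPrimaryTorsion 2 m) (fun m ↦ ?_) ?_
  · have htors : ∀ x ∈ κ.kerSubgroup, GaloisRep.cyclotomicCharacter K 2 x ∈ CommGroup.torsion ℤ_[2]ˣ := by
      intro x hx
      rw [show κ.kerSubgroup = _ from hκ] at hx
      exact Subgroup.mem_comap.mp hx
    have hneg : ∀ x ∈ κ.kerSubgroup, x ∉ (GaloisRep.cyclotomicCharacter K 2).toMonoidHom.ker →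
        GaloisRep.cyclotomicCharacter K 2 x = -1 := by
      intro x hx hx'
      rcases OddSplit.eq_one_or_eq_neg_one_of_mem_torsion (htors x hx) with h1 | h1
      · exact absurd ((MonoidHom.mem_ker).mpr h1) hx'
      · exact h1
    have e1 : (GaloisRep.cyclotomicCharacter K 2).toMonoidHom g = -1 := hneg g hg hg₁
    have e2 : (GaloisRep.cyclotomicCharacter K 2).toMonoidHom g' = -1 := hneg g' hg' hg'₁
    rw [MonoidHom.mem_ker, map_mul, e1, e2, neg_mul_neg, one_mul]
  · obtain ⟨k, hk⟩ := (AddCommGroup.mem_primaryComponent).1 m.2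
    exact ⟨k, Subtype.ext (by rw [AddSubgroupClass.coe_nsmul]; exact hk)⟩
  · haveI : Finite (geomTorsion W 2) := finite_torsionPoints_holds W (AlgebraicClosure K) two_ne_zero
    haveI : Finite {m : W.geomPrimaryTorsion 2 | (2 : ℕ) • m = 0} := by
      refine Finite.of_injective (fun m : {m : W.geomPrimaryTorsion 2 | (2 : ℕ) • m = 0} ↦
        (⟨((m : W.geomPrimaryTorsion 2) : W.geomPoints), ?_⟩ : geomTorsion W 2)) ?_
      · have hm : (2 : ℕ) • (m : W.geomPrimaryTorsion 2) = 0 := m.2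
        refine AddSubgroup.torsionBy.nsmul_iff.mpr ?_
        rw [← AddSubgroupClass.coe_nsmul, hm]; rfl
      · intro x y hxy
        have h := congrArg Subtype.val hxy
        dsimp only at h
        exact Subtype.ext (Subtype.ext h)
    exact Set.toFinite _

end Two

end Summit.BirchSwinnertonDyer.BirchSwinnertonDyer.Theorems.AlignedTransportAtTwoFineRoad.LocalTwo

end
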